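import Mathlib.Analysis.SpecialFunctions.Pow.Asymptotics
import Mathlib.Analysis.Asymptotics.AsymptoticEquivalent

/-!
# SoloInformedPartialSummation — the partial summation between `θ`-type sums and prime-value counts, for weights `d log n + O(1)`

Solo unit `solo-Parity-informed` (ideation tier, informed mode), session 12; `PLAN.md` §19.3(a), CLAIMS C49.

`SoloInformedGeneralPolynomialSplit` localised the `ψ`-form of Bateman–Horn for an arbitrary one-polynomial system `![g]`
(`ψ_g(x) = ∑_{n ≤ x} Λ(|g(n)|) ~ C(g) x ⟺ T_g(x; y) = o(x)`).  The conjunct itself is stated at the `π`-level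
(`polyPrimeCount`, main term `(C(g)/deg g) · x/log x`).  The bridge is the partial summation with the weights
`w(n) = log |g(n)| = deg g · log n + O(1)`; this file proves it ABSTRACTLY, for an arbitrary decidable predicate `p` on `ℕ`
(think `p n :⟺ |g(n)| prime`) and an arbitrary weight `w ≥ 0` with `|w(n) - d log n| ≤ B` (`n ≥ 1`):

  `P(x) := #{1 ≤ n ≤ x : p n}`,   `θ(x) := ∑_{1 ≤ n ≤ x, p n} w(n)`.

* `isEquivalent_iff_upper_lower` — for eventually positive `v`: `u ~ v` iff `(1-c) v ≤ u ≤ (1+c) v` eventually, every `c > 0`;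
* `weightedCount_le_card_mul` — `θ(x) ≤ P(x) (d log x + B)`;
  `card_sub_mul_le_weightedCount` — `(P(x) - y) L ≤ θ(x)` whenever `w(n) ≥ L ≥ 0` for `n > y`;
* four scalar cores and the four one-sided transfers (`eventually_card_le_of_weightedSum_le`, …), with the cut
  `y = ⌊x^{1-c/8}⌋` on the two sides that need one;
* `isEquivalent_weightedSum_iff_card` — **`θ(x) ~ C x ⟺ P(x) ~ (C/d) · x/log x`** (`C, d > 0`).

Elementary real analysis (Mathlib only).  The polynomial weights `w(n) = log |g(n)|` are supplied by
`SoloInformedPolynomialGrowth`; both are used by `SoloInformedPolynomialPrimeCount`.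
-/

namespace Summit.Parity.BatemanHorn.Theorems

open Finset Filter Asymptotics
open scoped Topology

/-! ### `IsEquivalent` along `ℕ` as a pair of one-sided eventual bounds -/

/-- For an eventually positive comparison function `v`: `u ~ v` iff for every `c > 0` eventually
`(1 - c) v ≤ u ≤ (1 + c) v`. -/
theorem isEquivalent_iff_upper_lower {u v : ℕ → ℝ} (hv : ∀ᶠ x : ℕ in atTop, 0 < v x) :
    u ~[atTop] v ↔
      (∀ c : ℝ, 0 < c → ∀ᶠ x : ℕ in atTop, u x ≤ (1 + c) * v x) ∧
        (∀ c : ℝ, 0 < c → ∀ᶠ x : ℕ in atTop, (1 - c) * v x ≤ u x) := by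
  rw [IsEquivalent, isLittleO_iff]
  constructor
  · intro h
    refine ⟨fun c hc => ?_, fun c hc => ?_⟩
    · filter_upwards [h hc, hv] with x hx hv0
      rw [Pi.sub_apply, Real.norm_eq_abs, Real.norm_eq_abs, abs_of_pos hv0] at hx
      have := (abs_le.mp hx).2
      linarith
    · filter_upwards [h hc, hv] with x hx hv0
      rw [Pi.sub_apply, Real.norm_eq_abs, Real.norm_eq_abs, abs_of_pos hv0] at hx
      have := (abs_le.mp hx).1
      linarith
  · rintro ⟨h1, h2⟩ c hc
    filter_upwards [h1 c hc, h2 c hc, hv] with x hx1 hx2 hv0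
    rw [Pi.sub_apply, Real.norm_eq_abs, Real.norm_eq_abs, abs_of_pos hv0, abs_le]
    constructor <;> linarith

/-! ### The two fixed-`x` inequalities of the partial summation -/

/-- Upper side: `∑_{n ≤ x, p n} w(n) ≤ #{n ≤ x : p n} · (d log x + B)` when `w(n) ≤ d log n + B` for `n ≥ 1`
(`d ≥ 0`). -/
theorem weightedCount_le_card_mul {p : ℕ → Prop} [DecidablePred p] {w : ℕ → ℝ} {d B : ℝ}
    (hd : 0 ≤ d) (hw : ∀ n : ℕ, 1 ≤ n → w n ≤ d * Real.log n + B) (x : ℕ) :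
    ∑ n ∈ (Icc 1 x).filter p, w n ≤ (#((Icc 1 x).filter p) : ℝ) * (d * Real.log x + B) := by
  rw [← nsmul_eq_mul]
  refine sum_le_card_nsmul _ _ _ fun n hn => ?_
  obtain ⟨hn1, hnx⟩ := mem_Icc.mp (mem_filter.mp hn).1
  have h1 : Real.log n ≤ Real.log x :=
    Real.log_le_log (Nat.cast_pos.mpr (by omega)) (by exact_mod_cast hnx)
  have h2 : d * Real.log n ≤ d * Real.log x := mul_le_mul_of_nonneg_left h1 hd
  linarith [hw n hn1]

/-- Lower side: if every counted `n > y` weighs at least `L ≥ 0` (and `w ≥ 0`), then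
`(#{n ≤ x : p n} - y) · L ≤ ∑_{n ≤ x, p n} w(n)`. -/
theorem card_sub_mul_le_weightedCount {p : ℕ → Prop} [DecidablePred p] {w : ℕ → ℝ}
    (hw0 : ∀ n : ℕ, 0 ≤ w n) (x y : ℕ) {L : ℝ} (hL0 : 0 ≤ L)
    (hL : ∀ n : ℕ, y < n → L ≤ w n) :
    ((#((Icc 1 x).filter p) : ℝ) - y) * L ≤ ∑ n ∈ (Icc 1 x).filter p, w n := by
  have hsplit : #((Icc 1 x).filter p)
      ≤ y + #(((Icc 1 x).filter p).filter fun n : ℕ => y < n) := by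
    calc #((Icc 1 x).filter p)
        ≤ #(Icc 1 y ∪ ((Icc 1 x).filter p).filter fun n : ℕ => y < n) := by
          refine card_le_card fun n hn => ?_
          rw [mem_union]
          by_cases h : n ≤ y
          · exact Or.inl (mem_Icc.mpr ⟨(mem_Icc.mp (mem_filter.mp hn).1).1, h⟩)
          · exact Or.inr (mem_filter.mpr ⟨hn, not_le.mp h⟩)
      _ ≤ #(Icc 1 y) + #(((Icc 1 x).filter p).filter fun n : ℕ => y < n) := card_union_le _ _
      _ = y + #(((Icc 1 x).filter p).filter fun n : ℕ => y < n) := by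
          rw [Nat.card_Icc, Nat.add_sub_cancel]
  have hsplitR : (#((Icc 1 x).filter p) : ℝ) - y
      ≤ (#(((Icc 1 x).filter p).filter fun n : ℕ => y < n) : ℝ) := by
    have h : (#((Icc 1 x).filter p) : ℝ)
        ≤ (y : ℝ) + (#(((Icc 1 x).filter p).filter fun n : ℕ => y < n) : ℝ) := by
      exact_mod_cast hsplit
    linarith
  calc ((#((Icc 1 x).filter p) : ℝ) - y) * L
      ≤ (#(((Icc 1 x).filter p).filter fun n : ℕ => y < n) : ℝ) * L :=
        mul_le_mul_of_nonneg_right hsplitR hL0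
    _ ≤ ∑ n ∈ ((Icc 1 x).filter p).filter (fun n : ℕ => y < n), w n := by
        rw [← nsmul_eq_mul]
        exact card_nsmul_le_sum _ _ _ fun n hn => hL n (mem_filter.mp hn).2
    _ ≤ ∑ n ∈ (Icc 1 x).filter p, w n :=
        sum_le_sum_of_subset_of_nonneg (filter_subset _ _) fun n _ _ => hw0 n

/-! ### Scalar cores (`m = (C/d) X/ℓ`, so that `C X = m · d ℓ`) -/

/-- Core of "count upper bound ⟹ weighted-sum upper bound". -/
theorem weightedSum_upper_core {C d X ℓ c B P T : ℝ} (hC : 0 < C) (hd : 0 < d) (hX : 0 < X)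
    (hℓ : 0 < ℓ) (hB0 : 0 ≤ B) (hB : (2 + c) * B ≤ c * d * ℓ)
    (hP : P ≤ (1 + c / 2) * (C / d * X / ℓ)) (hT : T ≤ P * (d * ℓ + B)) :
    T ≤ (1 + c) * (C * X) := by
  set m := C / d * X / ℓ with hm_def
  have hm : m * (d * ℓ) = C * X := by rw [hm_def]; field_simp
  have hm0 : 0 < m := by positivity
  have h1 : P * (d * ℓ + B) ≤ (1 + c / 2) * m * (d * ℓ + B) :=
    mul_le_mul_of_nonneg_right hP (by positivity)
  have h2 : 0 ≤ m * (c * d * ℓ - (2 + c) * B) := mul_nonneg hm0.le (by linarith)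
  rw [← hm]
  nlinarith [h1, h2, hT]

/-- Core of "weighted-sum lower bound ⟹ count lower bound". -/
theorem card_lower_core {C d X ℓ c B P T : ℝ} (hC : 0 < C) (hd : 0 < d) (hX : 0 < X)
    (hℓ : 0 < ℓ) (hc : 0 < c) (hB0 : 0 ≤ B) (hB : 2 * B ≤ c * d * ℓ)
    (hθ : (1 - c / 2) * (C * X) ≤ T) (hU : T ≤ P * (d * ℓ + B)) :
    (1 - c) * (C / d * X / ℓ) ≤ P := by
  set m := C / d * X / ℓ with hm_def
  have hm : m * (d * ℓ) = C * X := by rw [hm_def]; field_simp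
  have hm0 : 0 < m := by positivity
  have hK : 0 < d * ℓ + B := by positivity
  refine le_of_mul_le_mul_right ?_ hK
  have h2 : 0 ≤ m * (c * d * ℓ - 2 * B) := mul_nonneg hm0.le (by linarith)
  have h3 : 0 ≤ c * (m * B) := by positivity
  rw [← hm] at hθ
  nlinarith [h2, h3, hθ, hU]

/-- Core of "weighted-sum upper bound ⟹ count upper bound" (cut at `X^{1-c/8}`, value `Xp`, floor `yv`). -/
theorem card_upper_core {C d X ℓ c B P T yv Xp : ℝ} (hC : 0 < C) (hd : 0 < d) (hX : 0 < X)
    (hℓ : 0 < ℓ) (hc : 0 < c) (hc1 : c ≤ 1) (hB0 : 0 ≤ B) (hB : 10 * B ≤ c * d * ℓ)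
    (hT : T ≤ (1 + c / 8) * (C * X))
    (hL : (P - yv) * ((1 - c / 8) * d * ℓ - B) ≤ T) (hy : yv ≤ Xp) (hXp0 : 0 ≤ Xp)
    (hXp : d * ℓ * Xp ≤ c / 4 * (C * X)) :
    P ≤ (1 + c) * (C / d * X / ℓ) := by
  set m := C / d * X / ℓ with hm_def
  have hm : m * (d * ℓ) = C * X := by rw [hm_def]; field_simp
  have hm0 : 0 < m := by positivity
  have hdl : 0 < d * ℓ := mul_pos hd hℓ
  have hcdl : c * (d * ℓ) ≤ d * ℓ := mul_le_of_le_one_left hdl.le hc1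
  have hL0 : 0 < (1 - c / 8) * d * ℓ - B := by nlinarith
  refine le_of_mul_le_mul_right ?_ hL0
  rw [← hm] at hT hXp
  have h1 : yv * ((1 - c / 8) * d * ℓ - B) ≤ Xp * (d * ℓ) := by
    calc yv * ((1 - c / 8) * d * ℓ - B) ≤ Xp * ((1 - c / 8) * d * ℓ - B) :=
          mul_le_mul_of_nonneg_right hy hL0.le
      _ ≤ Xp * (d * ℓ) := mul_le_mul_of_nonneg_left (by nlinarith) hXp0
  have h2 : 0 ≤ m * (c * d * ℓ - 10 * B) := mul_nonneg hm0.le (by linarith)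
  have h3 : 0 ≤ m * (d * ℓ) * (c - c ^ 2) := mul_nonneg (by positivity) (by nlinarith)
  have h4 : 0 ≤ (1 - c) * (m * B) := mul_nonneg (by linarith) (by positivity)
  have h5 : 0 ≤ m * B := by positivity
  have h6 : 0 ≤ c * (m * (d * ℓ)) := by positivity
  nlinarith [h1, h2, h3, h4, h5, h6, hT, hL, hXp]

/-- Core of "count lower bound ⟹ weighted-sum lower bound" (same cut). -/
theorem weightedSum_lower_core {C d X ℓ c B P T yv Xp : ℝ} (hC : 0 < C) (hd : 0 < d) (hX : 0 < X)
    (hℓ : 0 < ℓ) (hc : 0 < c) (hc1 : c ≤ 1) (hB0 : 0 ≤ B) (hB : 10 * B ≤ c * d * ℓ)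
    (hP : (1 - c / 8) * (C / d * X / ℓ) ≤ P)
    (hL : (P - yv) * ((1 - c / 8) * d * ℓ - B) ≤ T) (hy : yv ≤ Xp) (hXp0 : 0 ≤ Xp)
    (hXp : d * ℓ * Xp ≤ c / 4 * (C * X)) :
    (1 - c) * (C * X) ≤ T := by
  set m := C / d * X / ℓ with hm_def
  have hm : m * (d * ℓ) = C * X := by rw [hm_def]; field_simp
  have hm0 : 0 < m := by positivity
  have hdl : 0 < d * ℓ := mul_pos hd hℓ
  have hcdl : c * (d * ℓ) ≤ d * ℓ := mul_le_of_le_one_left hdl.le hc1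
  have hL0 : 0 ≤ (1 - c / 8) * d * ℓ - B := by nlinarith
  rw [← hm] at hXp ⊢
  have h1 : ((1 - c / 8) * m - Xp) * ((1 - c / 8) * d * ℓ - B)
      ≤ (P - yv) * ((1 - c / 8) * d * ℓ - B) :=
    mul_le_mul_of_nonneg_right (by linarith) hL0
  have h2 : 0 ≤ m * (c * d * ℓ - 10 * B) := mul_nonneg hm0.le (by linarith)
  have h3 : Xp * ((1 - c / 8) * d * ℓ - B) ≤ Xp * (d * ℓ) :=
    mul_le_mul_of_nonneg_left (by nlinarith) hXp0
  have h4 : 0 ≤ c ^ 2 * (m * (d * ℓ)) := by positivity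
  have h5 : 0 ≤ c * (m * B) := by positivity
  have h6 : 0 ≤ c * (m * (d * ℓ)) := by positivity
  nlinarith [h1, h2, h3, h4, h5, h6, hL, hXp, hP]

/-! ### The eventual inequalities feeding the cores -/

/-- For fixed `c > 0`, eventually in `x ∈ ℕ`: `10 B ≤ c d log x`, `d log x · x^{1-c/8} ≤ (c/4) C x`, `x ≥ 2`. -/
theorem eventually_cores_aux {d C B : ℝ} (hd : 0 < d) (hC : 0 < C) {c : ℝ} (hc : 0 < c) :
    ∀ᶠ x : ℕ in atTop, 10 * B ≤ c * d * Real.log x ∧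
      d * Real.log x * (x : ℝ) ^ (1 - c / 8) ≤ c / 4 * (C * x) ∧ (2 : ℝ) ≤ x := by
  have hlogT : Tendsto (fun x : ℕ => Real.log (x : ℝ)) atTop atTop :=
    Real.tendsto_log_atTop.comp tendsto_natCast_atTop_atTop
  have e1 : ∀ᶠ x : ℕ in atTop, 10 * B / (c * d) ≤ Real.log x := hlogT.eventually_ge_atTop _
  have e2 : ∀ᶠ t : ℝ in atTop, ‖Real.log t‖ ≤ c * C / (4 * d) * ‖t ^ (c / 8)‖ :=
    (isLittleO_log_rpow_atTop (by positivity : 0 < c / 8)).bound (by positivity)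
  filter_upwards [e1, tendsto_natCast_atTop_atTop.eventually e2, eventually_ge_atTop 2]
    with x hx1 hx2 hx3
  have hX : (2 : ℝ) ≤ x := by exact_mod_cast hx3
  have hX0 : (0 : ℝ) < x := by linarith
  refine ⟨?_, ?_, hX⟩
  · have h := (div_le_iff₀ (by positivity)).mp hx1
    linarith
  · rw [Real.norm_eq_abs, Real.norm_eq_abs, abs_of_pos (Real.log_pos (by linarith)),
      abs_of_pos (Real.rpow_pos_of_pos hX0 _)] at hx2
    have h := mul_le_mul_of_nonneg_right hx2 (by positivity : (0 : ℝ) ≤ (x : ℝ) ^ (1 - c / 8))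
    rw [mul_assoc, ← Real.rpow_add hX0, show c / 8 + (1 - c / 8) = (1 : ℝ) by ring,
      Real.rpow_one] at h
    have h' : d * (Real.log x * (x : ℝ) ^ (1 - c / 8)) ≤ d * (c * C / (4 * d) * x) :=
      mul_le_mul_of_nonneg_left h hd.le
    have hcalc : d * (c * C / (4 * d) * (x : ℝ)) = c / 4 * (C * x) := by
      field_simp
    calc d * Real.log x * (x : ℝ) ^ (1 - c / 8) = d * (Real.log x * (x : ℝ) ^ (1 - c / 8)) := by ring
      _ ≤ d * (c * C / (4 * d) * x) := h'
      _ = c / 4 * (C * x) := hcalc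

/-- At the cut `y = ⌊x^{1-c/8}⌋`: every `n > y` weighs at least `(1 - c/8) d log x - B`. -/
theorem weight_lower_beyond_cut {w : ℕ → ℝ} {d B : ℝ} (hd : 0 ≤ d)
    (hwL : ∀ n : ℕ, 1 ≤ n → d * Real.log n - B ≤ w n) {x : ℕ} (hx : 0 < x) (c : ℝ) {n : ℕ}
    (hn : ⌊(x : ℝ) ^ (1 - c / 8)⌋₊ < n) : (1 - c / 8) * d * Real.log x - B ≤ w n := by
  have hX0 : (0 : ℝ) < x := by exact_mod_cast hx
  have hn1 : 1 ≤ n := by omega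
  have hyn : (x : ℝ) ^ (1 - c / 8) < n :=
    (Nat.lt_floor_add_one _).trans_le (by exact_mod_cast hn)
  have hlog : (1 - c / 8) * Real.log x ≤ Real.log n := by
    rw [← Real.log_rpow hX0]
    exact Real.log_le_log (Real.rpow_pos_of_pos hX0 _) hyn.le
  have h1 := hwL n hn1
  have h2 : d * ((1 - c / 8) * Real.log x) ≤ d * Real.log n := mul_le_mul_of_nonneg_left hlog hd
  linarith

/-! ### The four one-sided transfers -/

section Transfers

variable {p : ℕ → Prop} [DecidablePred p] {w : ℕ → ℝ} {d B C : ℝ}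

/-- **Weighted sum ≤ ⟹ count ≤.**  If `θ(x) ≤ (1 + c) C x` eventually for every `c > 0`, then
`P(x) ≤ (1 + c) (C/d) x/log x` eventually for every `c > 0`. -/
theorem eventually_card_le_of_weightedSum_le (hd : 0 < d) (hC : 0 < C) (hw0 : ∀ n : ℕ, 0 ≤ w n)
    (hw : ∀ n : ℕ, 1 ≤ n → |w n - d * Real.log n| ≤ B)
    (hθ : ∀ c : ℝ, 0 < c → ∀ᶠ x : ℕ in atTop,
      ∑ n ∈ (Icc 1 x).filter p, w n ≤ (1 + c) * (C * x)) :
    ∀ c : ℝ, 0 < c → ∀ᶠ x : ℕ in atTop,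
      (#((Icc 1 x).filter p) : ℝ) ≤ (1 + c) * (C / d * x / Real.log x) := by
  have hB0 : 0 ≤ B := (abs_nonneg _).trans (hw 1 le_rfl)
  have hwL : ∀ n : ℕ, 1 ≤ n → d * Real.log n - B ≤ w n := fun n hn => by
    have h := (abs_le.mp (hw n hn)).1
    linarith
  intro c hc
  have hc'0 : 0 < min c 1 := lt_min hc one_pos
  have hc'1 : min c 1 ≤ 1 := min_le_right _ _
  have hc'c : min c 1 ≤ c := min_le_left _ _
  filter_upwards [hθ (min c 1 / 8) (by positivity), eventually_cores_aux (B := B) hd hC hc'0]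
    with x hT h
  obtain ⟨hB, hXp, hX2⟩ := h
  have hX0 : (0 : ℝ) < x := by linarith
  have hℓ : 0 < Real.log (x : ℝ) := Real.log_pos (by linarith)
  have hdl : 0 < d * Real.log x := mul_pos hd hℓ
  have hL0 : 0 ≤ (1 - min c 1 / 8) * d * Real.log x - B := by
    have : min c 1 * (d * Real.log x) ≤ d * Real.log x := mul_le_of_le_one_left hdl.le hc'1
    nlinarith
  have hL := card_sub_mul_le_weightedCount (p := p) hw0 x ⌊(x : ℝ) ^ (1 - min c 1 / 8)⌋₊ hL0
    fun n hn => weight_lower_beyond_cut hd.le hwL (Nat.cast_pos.mp hX0) (min c 1) hn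
  have hmain := card_upper_core hC hd hX0 hℓ hc'0 hc'1 hB0 hB hT hL
    (Nat.floor_le (by positivity)) (by positivity) hXp
  have hm0 : 0 < C / d * x / Real.log x := by positivity
  calc _ ≤ (1 + min c 1) * (C / d * x / Real.log x) := hmain
    _ ≤ (1 + c) * (C / d * x / Real.log x) := by gcongr

/-- **Weighted sum ≥ ⟹ count ≥.** -/
theorem eventually_le_card_of_le_weightedSum (hd : 0 < d) (hC : 0 < C)
    (hw : ∀ n : ℕ, 1 ≤ n → |w n - d * Real.log n| ≤ B)
    (hθ : ∀ c : ℝ, 0 < c → ∀ᶠ x : ℕ in atTop,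
      (1 - c) * (C * x) ≤ ∑ n ∈ (Icc 1 x).filter p, w n) :
    ∀ c : ℝ, 0 < c → ∀ᶠ x : ℕ in atTop,
      (1 - c) * (C / d * x / Real.log x) ≤ (#((Icc 1 x).filter p) : ℝ) := by
  have hB0 : 0 ≤ B := (abs_nonneg _).trans (hw 1 le_rfl)
  have hwU : ∀ n : ℕ, 1 ≤ n → w n ≤ d * Real.log n + B := fun n hn => by
    have h := (abs_le.mp (hw n hn)).2
    linarith
  intro c hc
  have hc'0 : 0 < min c 1 := lt_min hc one_pos
  have hc'c : min c 1 ≤ c := min_le_left _ _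
  filter_upwards [hθ (min c 1 / 2) (by positivity), eventually_cores_aux (B := B) hd hC hc'0]
    with x hT h
  obtain ⟨hB, -, hX2⟩ := h
  have hX0 : (0 : ℝ) < x := by linarith
  have hℓ : 0 < Real.log (x : ℝ) := Real.log_pos (by linarith)
  have hU := weightedCount_le_card_mul (p := p) hd.le hwU x
  have hmain := card_lower_core hC hd hX0 hℓ hc'0 hB0 (by linarith) hT hU
  have hm0 : 0 < C / d * x / Real.log x := by positivity
  calc (1 - c) * (C / d * x / Real.log x) ≤ (1 - min c 1) * (C / d * x / Real.log x) :=
        mul_le_mul_of_nonneg_right (by linarith) hm0.le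
    _ ≤ _ := hmain

/-- **Count ≤ ⟹ weighted sum ≤.** -/
theorem eventually_weightedSum_le_of_card_le (hd : 0 < d) (hC : 0 < C)
    (hw : ∀ n : ℕ, 1 ≤ n → |w n - d * Real.log n| ≤ B)
    (hP : ∀ c : ℝ, 0 < c → ∀ᶠ x : ℕ in atTop,
      (#((Icc 1 x).filter p) : ℝ) ≤ (1 + c) * (C / d * x / Real.log x)) :
    ∀ c : ℝ, 0 < c → ∀ᶠ x : ℕ in atTop,
      ∑ n ∈ (Icc 1 x).filter p, w n ≤ (1 + c) * (C * x) := by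
  have hB0 : 0 ≤ B := (abs_nonneg _).trans (hw 1 le_rfl)
  have hwU : ∀ n : ℕ, 1 ≤ n → w n ≤ d * Real.log n + B := fun n hn => by
    have h := (abs_le.mp (hw n hn)).2
    linarith
  intro c hc
  have hc'0 : 0 < min c 1 := lt_min hc one_pos
  have hc'1 : min c 1 ≤ 1 := min_le_right _ _
  have hc'c : min c 1 ≤ c := min_le_left _ _
  filter_upwards [hP (min c 1 / 2) (by positivity), eventually_cores_aux (B := B) hd hC hc'0]
    with x hPx h
  obtain ⟨hB, -, hX2⟩ := h
  have hX0 : (0 : ℝ) < x := by linarith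
  have hℓ : 0 < Real.log (x : ℝ) := Real.log_pos (by linarith)
  have hU := weightedCount_le_card_mul (p := p) hd.le hwU x
  have hB' : (2 + min c 1) * B ≤ min c 1 * d * Real.log x := by
    have : 0 ≤ (1 - min c 1) * B := mul_nonneg (by linarith) hB0
    nlinarith
  have hmain := weightedSum_upper_core hC hd hX0 hℓ hB0 hB' hPx hU
  have hm0 : 0 < C * (x : ℝ) := by positivity
  calc _ ≤ (1 + min c 1) * (C * x) := hmain
    _ ≤ (1 + c) * (C * x) := by gcongr

/-- **Count ≥ ⟹ weighted sum ≥.** -/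
theorem eventually_le_weightedSum_of_le_card (hd : 0 < d) (hC : 0 < C) (hw0 : ∀ n : ℕ, 0 ≤ w n)
    (hw : ∀ n : ℕ, 1 ≤ n → |w n - d * Real.log n| ≤ B)
    (hP : ∀ c : ℝ, 0 < c → ∀ᶠ x : ℕ in atTop,
      (1 - c) * (C / d * x / Real.log x) ≤ (#((Icc 1 x).filter p) : ℝ)) :
    ∀ c : ℝ, 0 < c → ∀ᶠ x : ℕ in atTop,
      (1 - c) * (C * x) ≤ ∑ n ∈ (Icc 1 x).filter p, w n := by
  have hB0 : 0 ≤ B := (abs_nonneg _).trans (hw 1 le_rfl)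
  have hwL : ∀ n : ℕ, 1 ≤ n → d * Real.log n - B ≤ w n := fun n hn => by
    have h := (abs_le.mp (hw n hn)).1
    linarith
  intro c hc
  have hc'0 : 0 < min c 1 := lt_min hc one_pos
  have hc'1 : min c 1 ≤ 1 := min_le_right _ _
  have hc'c : min c 1 ≤ c := min_le_left _ _
  filter_upwards [hP (min c 1 / 8) (by positivity), eventually_cores_aux (B := B) hd hC hc'0]
    with x hPx h
  obtain ⟨hB, hXp, hX2⟩ := h
  have hX0 : (0 : ℝ) < x := by linarith
  have hℓ : 0 < Real.log (x : ℝ) := Real.log_pos (by linarith)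
  have hdl : 0 < d * Real.log x := mul_pos hd hℓ
  have hL0 : 0 ≤ (1 - min c 1 / 8) * d * Real.log x - B := by
    have : min c 1 * (d * Real.log x) ≤ d * Real.log x := mul_le_of_le_one_left hdl.le hc'1
    nlinarith
  have hL := card_sub_mul_le_weightedCount (p := p) hw0 x ⌊(x : ℝ) ^ (1 - min c 1 / 8)⌋₊ hL0
    fun n hn => weight_lower_beyond_cut hd.le hwL (Nat.cast_pos.mp hX0) (min c 1) hn
  have hmain := weightedSum_lower_core hC hd hX0 hℓ hc'0 hc'1 hB0 hB hPx hL
    (Nat.floor_le (by positivity)) (by positivity) hXp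
  have hm0 : 0 < C * (x : ℝ) := by positivity
  calc (1 - c) * (C * x) ≤ (1 - min c 1) * (C * x) :=
        mul_le_mul_of_nonneg_right (by linarith) hm0.le
    _ ≤ _ := hmain

/-- **The partial summation, both ways: `θ(x) ~ C x ⟺ P(x) ~ (C/d) x/log x`** for a weight
`w ≥ 0` with `|w(n) - d log n| ≤ B` (`n ≥ 1`) and `C, d > 0`. -/
theorem isEquivalent_weightedSum_iff_card (hd : 0 < d) (hC : 0 < C) (hw0 : ∀ n : ℕ, 0 ≤ w n)
    (hw : ∀ n : ℕ, 1 ≤ n → |w n - d * Real.log n| ≤ B) :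
    ((fun x : ℕ => ∑ n ∈ (Icc 1 x).filter p, w n) ~[atTop] fun x : ℕ => C * (x : ℝ)) ↔
      ((fun x : ℕ => (#((Icc 1 x).filter p) : ℝ)) ~[atTop]
        fun x : ℕ => C / d * (x : ℝ) / Real.log x) := by
  have hv1 : ∀ᶠ x : ℕ in atTop, 0 < C * (x : ℝ) := by
    filter_upwards [eventually_ge_atTop 1] with x hx
    have : (0 : ℝ) < x := Nat.cast_pos.mpr (by omega)
    positivity
  have hv2 : ∀ᶠ x : ℕ in atTop, 0 < C / d * (x : ℝ) / Real.log x := by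
    filter_upwards [eventually_ge_atTop 2] with x hx
    have hX : (2 : ℝ) ≤ x := by exact_mod_cast hx
    have := Real.log_pos (by linarith : (1 : ℝ) < x)
    positivity
  rw [isEquivalent_iff_upper_lower hv1, isEquivalent_iff_upper_lower hv2]
  constructor
  · rintro ⟨h1, h2⟩
    exact ⟨eventually_card_le_of_weightedSum_le hd hC hw0 hw h1,
      eventually_le_card_of_le_weightedSum hd hC hw h2⟩
  · rintro ⟨h1, h2⟩
    exact ⟨eventually_weightedSum_le_of_card_le hd hC hw h1,
      eventually_le_weightedSum_of_le_card hd hC hw0 hw h2⟩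

end Transfers

end Summit.Parity.BatemanHorn.Theorems
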